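import Summits.ResolutionOfSingularities.ResolutionOfSingularities.Theorems.EquisingularLiftEquisingularLiftNatResidueHypDefsE11
import Literature.AlgebraicGeometry.Resolution.Blowups
import HarnessLib

/-!
# EL♮(3) / EL♮(n), RUNG LC «large characteristic» — brick (B3′)(f3): the POSITION TOKEN of `DescTransformOK` reduced to «the centre does not swallow
# the running transform», via the generic point of the running transform (an invariant carried along the tower)

leafhand-res-equisingularlift-3 g0 (prover, 2026-08-31; one-generation line-first hand on stmt-ResolutionOfSingularities-20148 / -20038 /
-15660, cell `pub/decomp-res`).  Crux `EquisingularLiftNatThree` (`stmt-…-20148`; uniform in `n`, so also `stmt-…-20038`), line W4.5(b), RUNG LC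
(idea-2 g32 `Cruxes/EquisingularLiftNatThree/LARGE-CHAR-RUNG-idea2.md` v1.6 §(B3′) (f3) «σ-image misses the generic point of `H_θ` (centre fibres have
dimension `≤ n − 2 < n − 1 = dim H_θ` …)», §(B5′)(c4)).  The position token of ✓ `DescTransformOK` (…NatResidueHypDefsE10 :60) at a stage
`(X, σ : X → P, Y)` over `(P, Y₀)` reads `σ '' C.support ⊆ {x | ¬ IsGenericPoint x Y₀}`.  Along an embedded-resolution tower the running transform `Y`
keeps ONE point over the generic point `η₀` of `Y₀` — its own generic point — because every blow-up is an isomorphism off its centre and (by the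
previous tokens) no centre meets that point.  This file isolates that invariant and proves, DEF-FREE and dimension-free:

* `image_support_subset_not_isGenericPoint_of_inv` — **token from the invariant**: if every point of `Y` lying over a generic point of `Y₀` is a
  generic point of `Y` (INV), `supp C ⊆ Y` (E1) and `¬ Y ⊆ supp C` (the centre does not swallow the transform), then
  `σ '' supp C ⊆ {x | ¬ IsGenericPoint x Y₀}` (a generic point of `Y` inside the closed `supp C` forces `Y ⊆ supp C`; Mathlib
  `IsGenericPoint.mem_closed_set_iff`);
* `inv_closure_preimage_diff_of_isBlowup` — **the invariant survives a blow-up**: for `π : X' → X` a blow-up along `C` (an isomorphism off `supp C`,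
  ✓ `IsBlowup.isIso_compl`), `Y` closed with INV and `¬ Y ⊆ supp C`, the strict transform `Y' = closure (π⁻¹ (Y ∖ supp C))` satisfies INV for
  `π ≫ σ`: a point `y'` of `Y'` over `η₀` lies over the generic point `η` of `Y`, `η ∉ supp C`, and over `X ∖ supp C` the blow-up is a homeomorphism,
  so `y'` specialises to every point of `π⁻¹ (Y ∖ supp C)` (Mathlib `Topology.IsInducing.specializes_iff`, `Scheme.homeoOfIso`), i.e. is generic in `Y'`;
* `inv_of_eq` — the invariant at the foot of the tower (`σ = 𝟙`, `Y = Y₀`).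

USE in the (B5) recursion: INV is threaded along `DescTransformOK`'s own recursion (foot: `inv_of_eq`; step: `inv_closure_preimage_diff_of_isBlowup` with
✓ `blowup.isBlowup`), so the position token at every stage costs exactly «`¬ supp (𝓣ᵢ.comap j) ⊆ supp (Cᵢ.comap j)`» on the fibre — the honest residual
of (f3): the `k`-fibre of the `B`-smooth centre (relative dimension `≤ n − 2`) cannot contain the `(n−1)`-dimensional strict transform of the integral
hypersurface `H_θ` (fibre-dimension theory: ✓ `topologicalKrullDim_fiber_eq_of_smoothOfRelativeDimension`-type results; NOT proved here).  EL♮(3) NOT proved;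
EL♮ NOT proved; resolution of singularities in positive characteristic NOT proved; nothing of [Hironaka2017] (a candidate under adjudication) is asserted or
used.  [OURS · point-set topology over ✓ `IsBlowup.isIso_compl` · standard axioms · DEF-FREE · `--supports stmt-ResolutionOfSingularities-20148 --as helper`,
counted 0 · AI-written, weaker than expert review.] [cite: GortzWedhorn2020, Prop. 13.91 (3)] [cite: StacksProject, Tag 02OS] (method; index only)
-/

set_option linter.dupNamespace false -- mandated namespace `Summit.<Summit>.<Problem>` of this single-conjunct summit

noncomputable section

open CategoryTheory CategoryTheory.Limits AlgebraicGeometry TopologicalSpace Topology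
open Literature.AlgebraicGeometry.Resolution
open AlgebraicGeometry.Scheme.IdealSheafData

namespace Summit.ResolutionOfSingularities.ResolutionOfSingularities.Cruxes.EquisingularLiftNat.Sections

section PositionToken

variable {P X : Scheme.{0}} (σ : X ⟶ P) (Y₀ : Set P) (Y : Set X)

/-- **The position token of `DescTransformOK` from the generic-point invariant**: if every point of the running transform `Y` over a generic point
of `Y₀` is a generic point of `Y` (INV), the centre lies in `Y` (E1) and does not swallow it (`¬ Y ⊆ supp C`), then the image of the centre misses the
generic points of `Y₀`. [folklore] [OURS · L1 W4.5b · RUNG LC (B3′)(f3) bookkeeping] -/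
theorem image_support_subset_not_isGenericPoint_of_inv (C : X.IdealSheafData)
    (hINV : ∀ y ∈ Y, IsGenericPoint (σ y) Y₀ → IsGenericPoint y Y)
    (hE1 : (C.support : Set X) ⊆ Y) (hne : ¬ Y ⊆ (C.support : Set X)) :
    σ '' (C.support : Set X) ⊆ {x | ¬ IsGenericPoint x Y₀} := by
  rintro _ ⟨c, hc, rfl⟩ hgen
  exact hne (((hINV c (hE1 hc) hgen).mem_closed_set_iff C.support.isClosed).mp hc)

/-- **The invariant at the foot of the tower**: for `σ = 𝟙` and `Y = Y₀` it is a tautology. [folklore] -/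
theorem inv_of_eq (Y₀ : Set P) : ∀ y ∈ Y₀, IsGenericPoint ((𝟙 P : P ⟶ P) y) Y₀ → IsGenericPoint y Y₀ :=
  fun y _ h => by simpa using h

variable {σ Y₀ Y}

/-- **The generic-point invariant survives a blow-up step.**  Let `π : X' → X` be a blow-up along `C` (so an isomorphism off `supp C`,
✓ `IsBlowup.isIso_compl`), `Y ⊆ X` closed with INV for `(σ, Y₀)` and `¬ Y ⊆ supp C`.  Then the strict transform `Y' = closure (π⁻¹ (Y ∖ supp C))`
satisfies INV for `(π ≫ σ, Y₀)`: a point `y' ∈ Y'` over a generic point of `Y₀` maps to a point of `Y` (`π '' Y' ⊆ Y`, `Y` closed) which is generic in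
`Y` by INV and hence off `supp C`; over `X ∖ supp C` the blow-up is a homeomorphism onto its image, so `y'` specialises to every point of
`π⁻¹ (Y ∖ supp C)` (these specialise from the generic point of `Y` downstairs), i.e. `closure {y'} = Y'`.
[cite: GortzWedhorn2020, Prop. 13.91 (3)] [OURS · L1 W4.5b · RUNG LC (B3′)(f3) bookkeeping] -/
theorem inv_closure_preimage_diff_of_isBlowup (hY : IsClosed Y) (C : X.IdealSheafData) {X' : Scheme.{0}} {π : X' ⟶ X} (hπ : IsBlowup π C)
    (hINV : ∀ y ∈ Y, IsGenericPoint (σ y) Y₀ → IsGenericPoint y Y) (hne : ¬ Y ⊆ (C.support : Set X)) :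
    ∀ y' ∈ closure (π ⁻¹' (Y \ (C.support : Set X))), IsGenericPoint ((π ≫ σ) y') Y₀ →
      IsGenericPoint y' (closure (π ⁻¹' (Y \ (C.support : Set X)))) := by
  intro y' hy' hgen
  set S : Set X' := π ⁻¹' (Y \ (C.support : Set X)) with hS
  -- `π y' ∈ Y` and it is a generic point of `Y`
  have hπS : π '' closure S ⊆ Y := by
    refine (image_closure_subset_closure_image π.continuous).trans ?_
    rw [hY.closure_subset_iff]
    rintro _ ⟨z, hz, rfl⟩
    exact hz.1
  have hπy : π y' ∈ Y := hπS ⟨y', hy', rfl⟩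
  rw [Scheme.Hom.comp_apply] at hgen
  have hη : IsGenericPoint (π y') Y := hINV _ hπy hgen
  -- hence `π y' ∉ supp C`
  have hηC : π y' ∉ (C.support : Set X) := fun h => hne ((hη.mem_closed_set_iff C.support.isClosed).mp h)
  -- the open `W₀ = X ∖ supp C` over which `π` is an isomorphism
  set W₀ : X.Opens := ⟨(C.support : Set X)ᶜ, C.support.isClosed.isOpen_compl⟩ with hW₀
  haveI : IsIso (π ∣_ W₀) := hπ.isIso_compl
  let e : ↥(π ⁻¹ᵁ W₀) ≃ₜ ↥W₀ := Scheme.homeoOfIso (asIso (π ∣_ W₀))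
  have he : ∀ a : ↥(π ⁻¹ᵁ W₀), ((e a : ↥W₀) : X) = π (a : X') := fun a => by
    show ((π ∣_ W₀) a).1 = π a.1
    exact morphismRestrict_base_coe π W₀ a
  -- `closure {y'} = Y'`
  rw [isGenericPoint_def]
  refine le_antisymm (closure_minimal (Set.singleton_subset_iff.mpr hy') isClosed_closure) (closure_minimal ?_ isClosed_closure)
  intro z hz
  -- `z ∈ S`: `π z ∈ Y ∖ supp C`; downstairs `π y' ⤳ π z`
  have hsp : π y' ⤳ π z := hη.specializes hz.1
  -- lift the specialisation along the homeomorphism `π⁻¹ W₀ ≃ W₀`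
  let a : ↥(π ⁻¹ᵁ W₀) := ⟨y', show π y' ∈ W₀ from hηC⟩
  let b : ↥(π ⁻¹ᵁ W₀) := ⟨z, show π z ∈ W₀ from hz.2⟩
  have h1 : (e a : ↥W₀) ⤳ e b := by
    rw [← Topology.IsInducing.subtypeVal.specializes_iff, he, he]
    exact hsp
  have h2 : a ⤳ b := (e.isInducing.specializes_iff).mp h1
  have h3 : (a : X') ⤳ (b : X') := h2.map continuous_subtype_val
  exact specializes_iff_mem_closure.mp h3

end PositionToken

end Summit.ResolutionOfSingularities.ResolutionOfSingularities.Cruxes.EquisingularLiftNat.Sections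

end
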